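import Literature.NumberTheory.EllipticCurves.ThreeTorsionFakePointToolkitProofs
import Literature.NumberTheory.EllipticCurves.ThreeTorsionFakePointProductsProofs
import Literature.NumberTheory.EllipticCurves.ThreeTorsionValuationCertificatesProofs
import HarnessLib

/-!
# The fake-point form of the Galois side of Ogg's formula at `2`: assembly from certificates

`Proofs` file (theorems only, no definitions, no named facts) in topic
`NumberTheory/EllipticCurves`, landed by the seat of bsd.S15
(`Literature.NumberTheory.EllipticCurves.conductorNorm_eq_artinConductorNat_of_isElliptic`),
continuing `ThreeTorsionFakePointProductsProofs`, `ThreeTorsionInertiaStructureProofs`,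
`ThreeTorsionFakePointToolkitProofs` and `ThreeTorsionValuationCertificatesProofs`.

The per-class files (one for each `2`-adic `(c₄, c₆)`-class of elliptic curves over `ℚ` with
additive, potentially good, non-abelian reduction at `2`) prove only *ring identities* in
`S_E = 𝓞̄ ∩ E`, `E = K(x(E[3]))`, of the shape `3^m X = 2^{a₀} U δ₁^{j₀} + 2^{a₁} V₁ δ₁^{j₁} + 2^{a₂} V₂ δ₁^{j₂}`
(`δ₁ = ∛Δ / 2^q`, `U` a unit at `𝔓`), from which `ThreeTorsionValuationCertificatesProofs` reads
off `3 v(X)` as a multiple of `v(2)`.  This file turns such valuation certificates into the Swan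
conductor:

* `three_mul_ord_eq_of_three_pow_mul_eq_dominant`, `ord_eq_of_three_pow_mul_eq_dominant`,
  `notMem_of_eq_intCast_add_two_mul` — the certificate-to-valuation lemmas in the exact shape the
  class files produce (a power of `3` on the left, a unit `a + bζ + 2Q` with `a` or `b` odd);
* `card_mul_swanConductorAt_torsion_three_eq_of_fakePoint_cert` — **the assembly**: in the
  setting of `card_mul_swanConductorAt_torsion_three_eq_of_fakePoint_prod` (`v ∣ 2` unramified,
  i.e. `2 ∉ v²`; `#Q₁(𝔓 ∩ E) = 4`; `#Q₀(𝔓 ∩ E) = 4e₀`), with `Δ = 2^{v_Δ} · unit` in `S_E`, a fake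
  point `(P, 2^γ)`, and the certificates `e₀ v(Z Z₂ Z₃ Z₄) = T_Z v(2)`,
  `e₀ v((Z - Z₂)(Z₃ - Z₄)) = T₀ v(2)`, … one gets
  `4e₀ · Sw_𝔓(E[3]) = 2 ((8e₀(γ+1) + 16e₀ + 2e₀v_Δ - T_Z) + Σ_k (2T_k - T_Z))`
  (`v_E(2) = #Q₀ = 4e₀` by Hilbert theory, so `v(∏ Z) = 4T_Z`, `v(E_k) = 4T_k`, `v(Δ) = 4e₀v_Δ`,
  `κ = v(2 · 2^γ) = 4e₀(γ+1)`, `4n₀ = 16 v(2) + 2 v(Δ)`);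
* `swanConductorAt_torsion_three_of_fakePoint_cert_three` — the case `e₀ = 3` (`3 ∤ v(Δ)`):
  `#Q₁ = 4` from the three quadratic defect certificates
  (`card_ramificationSubgroup_one_xDivisionField_three_eq_four_of_sq`) and `#Q₀ = 12`
  (`card_inertia_xDivisionField_three_eq_twelve`), then the assembly:
  `12 · Sw_𝔓(E[3]) = 2 ((24(γ+1) + 48 + 6v_Δ - T_Z) + Σ_k (2T_k - T_Z))`.

Ref: Serre, *Local Fields*, Ch. I §7 Prop. 20–22, Ch. IV §1–§2; Silverman *ATAEC* Thm. IV.11.1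
(`δ_𝔓` at `p = 2`). [cite: SerreLocalFields1979, Ch. IV §1–§2] [cite: SilvermanATAEC1994, Thm. IV.11.1]

Instance convention as in `ThreeTorsionFakePointSwanProofs` (`IntermediateField.algebra'`,
`AlgebraicClosure.instAlgebra` as the `𝓞 K`-algebra structures).

## References
* J.-P. Serre, *Local Fields*, GTM 67, Springer 1979, Ch. I §7, Ch. IV §1–§2.
* J. H. Silverman, *Advanced Topics in the Arithmetic of Elliptic Curves*, GTM 151, Springer 1994,
  Ch. IV §10–§11 (Ogg's formula, Thm. 11.1). [cite: SilvermanATAEC1994, Thm. IV.11.1]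
-/

noncomputable section

open scoped Classical NumberField Pointwise
open Field IsDedekindDomain Polynomial

attribute [local instance] AddSubgroup.torsionBy.zmodModule
attribute [local instance 1001] IntermediateField.algebra'
attribute [local instance 1002] AlgebraicClosure.instAlgebra

namespace Literature.NumberTheory.EllipticCurves

open Literature.NumberTheory.GaloisRepresentations

section Certificates

variable {B : Type*} [CommRing B] [IsDedekindDomain B] (P : Ideal B) [P.IsPrime]

omit [IsDedekindDomain B] in
/-- **Units `a + bζ + 2Q`**: if `ζ² + ζ + 1 = 0`, `2 ∈ 𝔓 ≠ ⊤`, `a` or `b` is odd and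
`U = a + bζ + 2Q`, then `U ∉ 𝔓`. [folklore] -/
theorem notMem_of_eq_intCast_add_two_mul {ζ : B} (hζ : ζ ^ 2 + ζ + 1 = 0) (h2 : (2 : B) ∈ P)
    (hP1 : P ≠ ⊤) {a b : ℤ} (hab : Odd a ∨ Odd b) {U : B} (Q : B)
    (hU : U = a + b * ζ + 2 * Q) : U ∉ P := by
  intro hmem
  apply intCast_add_intCast_mul_notMem_of_odd P hζ h2 hP1 hab
  have e : (a : B) + b * ζ = U - 2 * Q := by rw [hU]; ring
  rw [e]
  exact Ideal.sub_mem _ hmem (Ideal.mul_mem_right _ _ h2)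

omit [IsDedekindDomain B] in
/-- A power of `3` is a unit at a prime not containing `3`. [folklore] -/
theorem three_pow_notMem (h3 : (3 : B) ∉ P) (m : ℕ) : (3 : B) ^ m ∉ P :=
  fun h => h3 (Ideal.IsPrime.mem_of_pow_mem inferInstance m h)

/-- **Certificate → valuation, ramified cube root (`e₀ = 3`).**  If
`3^m X = 2^{a₀} U δ₁^{j₀} + 2^{a₁} V₁ δ₁^{j₁} + 2^{a₂} V₂ δ₁^{j₂}` with `3 ∉ 𝔓`, `U ∉ 𝔓`,
`3 v(δ₁) = r v(2)`, `0 < v(2) < ∞` and `3aᵢ + r jᵢ > 3a₀ + r j₀`, then `3 v(X) = (3a₀ + r j₀) v(2)`.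
[folklore] -/
theorem three_mul_ord_eq_of_three_pow_mul_eq_dominant (hP : P ≠ ⊥) (h3 : (3 : B) ∉ P)
    {o : ℕ} (ho : ord P (2 : B) = o) (hopos : 0 < o)
    {δ₁ : B} {r : ℕ} (hδ : 3 * ord P δ₁ = r * ord P (2 : B))
    {U : B} (hU : U ∉ P) (V₁ V₂ : B) {a₀ j₀ a₁ j₁ a₂ j₂ : ℕ}
    (h₁ : 3 * a₀ + r * j₀ < 3 * a₁ + r * j₁) (h₂ : 3 * a₀ + r * j₀ < 3 * a₂ + r * j₂)
    {X : B} {m : ℕ}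
    (hx : 3 ^ m * X = 2 ^ a₀ * U * δ₁ ^ j₀ + 2 ^ a₁ * V₁ * δ₁ ^ j₁ + 2 ^ a₂ * V₂ * δ₁ ^ j₂) :
    3 * ord P X = (3 * a₀ + r * j₀ : ℕ) * ord P (2 : B) := by
  have h := three_mul_ord_eq_of_dominant P hP ho hopos hδ hU V₁ V₂ h₁ h₂
  rw [← hx, ord_mul_of_notMem P hP (three_pow_notMem P h3 m)] at h
  exact h

/-- **Certificate → valuation, unit cube root (`e₀ = 1`).**  If
`3^m X = 2^ν U + 2^{b₁} V₁ w + 2^{b₂} V₂ w²` with `3 ∉ 𝔓`, `U ∉ 𝔓`, `v(w) ≥ 3 v(2)`,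
`0 < v(2) < ∞`, `ν + 1 ≤ b₁ + 3`, `ν + 1 ≤ b₂ + 6`, then `v(X) = ν v(2)`. [folklore] -/
theorem ord_eq_of_three_pow_mul_eq_dominant (hP : P ≠ ⊥) (h3 : (3 : B) ∉ P)
    {o : ℕ} (ho : ord P (2 : B) = o) (hopos : 0 < o)
    {w : B} (hw : ((3 * o : ℕ) : ℕ∞) ≤ ord P w) {U : B} (hU : U ∉ P) (V₁ V₂ : B) {ν b₁ b₂ : ℕ}
    (h₁ : ν + 1 ≤ b₁ + 3) (h₂ : ν + 1 ≤ b₂ + 6) {X : B} {m : ℕ}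
    (hx : 3 ^ m * X = 2 ^ ν * U + 2 ^ b₁ * V₁ * w + 2 ^ b₂ * V₂ * w ^ 2) :
    ord P X = (ν : ℕ∞) * ord P (2 : B) := by
  have h := ord_eq_of_dominant P hP ho hopos hw hU V₁ V₂ h₁ h₂
  rw [← hx, ord_mul_of_notMem P hP (three_pow_notMem P h3 m)] at h
  exact h

/-- `v(2ᵃ U) = a v(2)` for a unit `U`, in the `3 ·` normalisation. [folklore] -/
theorem three_mul_ord_two_pow_mul_of_notMem (hP : P ≠ ⊥) {U : B} (hU : U ∉ P) (a : ℕ) :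
    3 * ord P (2 ^ a * U) = (3 * a : ℕ) * ord P (2 : B) := by
  rw [ord_mul P hP, ord_pow P hP, (ord_eq_zero_iff P).mpr hU, add_zero]; push_cast; ring

end Certificates

end Literature.NumberTheory.EllipticCurves

namespace WeierstrassCurve

open Literature.NumberTheory.EllipticCurves Literature.NumberTheory.GaloisRepresentations

variable {K : Type} [Field K] [NumberField K] (W : WeierstrassCurve K)

set_option maxHeartbeats 1600000 in
set_option synthInstance.maxHeartbeats 400000 in
/-- **Assembly of the fake-point certificates.**  Setting of
`card_mul_swanConductorAt_torsion_three_eq_of_fakePoint_prod` with `2 ∉ v²` (so `v_E(2) = #Q₀(𝔓 ∩ E)`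
by Hilbert theory), `#Q₁(𝔓 ∩ E) = 4`, `#Q₀(𝔓 ∩ E) = 4e₀`, `Δ = 2^{v_Δ} · D_u` in `S_E` with `D_u` a
unit, a fake point `(P, c = 2^γ)` with test elements `Z_ε` and `Y_ε`, and the certificates
`e₀ v(Z Z₂ Z₃ Z₄) = T_Z v(2)` (`T_Z` odd), `e₀ v((Z - Z₂)(Z₃ - Z₄)) = T₀ v(2)`,
`e₀ v((Z - Z₃)(Z₂ - Z₄)) = T₁ v(2)`, `e₀ v((Z - Z₄)(Z₂ - Z₃)) = T₂ v(2)`.  Then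
`4e₀ · Sw_𝔓(E[3]) = 2 ((2 · 4e₀(γ+1) + (16e₀ + 2e₀v_Δ) - T_Z) + Σ_k (2T_k - T_Z))`.
[cite: SilvermanATAEC1994, Thm. IV.11.1] [cite: SerreLocalFields1979, Ch. IV §1–§2] -/
theorem card_mul_swanConductorAt_torsion_three_eq_of_fakePoint_cert [W.IsElliptic]
    {v : HeightOneSpectrum (𝓞 K)} (hv2 : (2 : 𝓞 K) ∈ v.asIdeal) (hπ2 : (2 : 𝓞 K) ∉ v.asIdeal ^ 2)
    {𝔓 : Ideal (absIntegers (𝓞 K) K)} (h𝔓 : 𝔓 ∈ v.primesAbove)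
    {ζ δ R₀ R₁ R₂ : AlgebraicClosure K} (hζ : ζ ^ 2 + ζ + 1 = 0)
    (hδ : δ ^ 3 = algebraMap K (AlgebraicClosure K) W.Δ)
    (h₀ : R₀ ^ 2 = algebraMap K (AlgebraicClosure K) W.c₄ - 12 * δ)
    (h₁ : R₁ ^ 2 = algebraMap K (AlgebraicClosure K) W.c₄ - 12 * ζ * δ)
    (h₂ : R₂ ^ 2 = algebraMap K (AlgebraicClosure K) W.c₄ - 12 * ζ ^ 2 * δ)
    (hρ : R₀ * R₁ * R₂ = algebraMap K (AlgebraicClosure K) W.c₆) (hc₆ : W.c₆ ≠ 0)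
    {D : 𝓞 K} (hD : algebraMap (𝓞 K) K D = W.Δ)
    (hcard : Nat.card ((𝔓.comap ((W.xDivisionField 3).integralClosureToAbsIntegers (𝓞 K))).ramificationSubgroup
      (W.xDivisionField 3 ≃ₐ[K] W.xDivisionField 3) 1) = 4)
    {e₀ : ℕ} (hG₀ : Nat.card ((𝔓.comap ((W.xDivisionField 3).integralClosureToAbsIntegers (𝓞 K))).ramificationSubgroup
      (W.xDivisionField 3 ≃ₐ[K] W.xDivisionField 3) 0) = 4 * e₀)
    {Du : integralClosure (𝓞 K) (W.xDivisionField 3)} {vD : ℕ}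
    (hDfac : algebraMap (𝓞 K) (integralClosure (𝓞 K) (W.xDivisionField 3)) D = 2 ^ vD * Du)
    (hDu : Du ∉ 𝔓.comap ((W.xDivisionField 3).integralClosureToAbsIntegers (𝓞 K)))
    {Z Z₂ Z₃ Z₄ Y₀ Y₂ Y₃ Y₄ sP : integralClosure (𝓞 K) (W.xDivisionField 3)} {P : Polynomial (𝓞 K)} {γ : ℕ}
    (hZ : ((Z : W.xDivisionField 3) : AlgebraicClosure K) =
      (P.map (algebraMap (𝓞 K) (AlgebraicClosure K))).eval (3 * (R₀ + R₁ + R₂)) ^ 2 -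
        algebraMap (𝓞 K) (AlgebraicClosure K) (2 ^ γ) ^ 2 * ((3 * (R₀ + R₁ + R₂)) ^ 3
          - 27 * algebraMap K _ W.c₄ * (3 * (R₀ + R₁ + R₂)) - 54 * algebraMap K _ W.c₆))
    (hZ₂ : ((Z₂ : W.xDivisionField 3) : AlgebraicClosure K) =
      (P.map (algebraMap (𝓞 K) (AlgebraicClosure K))).eval (3 * (R₀ - R₁ - R₂)) ^ 2 -
        algebraMap (𝓞 K) (AlgebraicClosure K) (2 ^ γ) ^ 2 * ((3 * (R₀ - R₁ - R₂)) ^ 3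
          - 27 * algebraMap K _ W.c₄ * (3 * (R₀ - R₁ - R₂)) - 54 * algebraMap K _ W.c₆))
    (hZ₃ : ((Z₃ : W.xDivisionField 3) : AlgebraicClosure K) =
      (P.map (algebraMap (𝓞 K) (AlgebraicClosure K))).eval (3 * (-R₀ + R₁ - R₂)) ^ 2 -
        algebraMap (𝓞 K) (AlgebraicClosure K) (2 ^ γ) ^ 2 * ((3 * (-R₀ + R₁ - R₂)) ^ 3
          - 27 * algebraMap K _ W.c₄ * (3 * (-R₀ + R₁ - R₂)) - 54 * algebraMap K _ W.c₆))
    (hZ₄ : ((Z₄ : W.xDivisionField 3) : AlgebraicClosure K) =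
      (P.map (algebraMap (𝓞 K) (AlgebraicClosure K))).eval (3 * (-R₀ - R₁ + R₂)) ^ 2 -
        algebraMap (𝓞 K) (AlgebraicClosure K) (2 ^ γ) ^ 2 * ((3 * (-R₀ - R₁ + R₂)) ^ 3
          - 27 * algebraMap K _ W.c₄ * (3 * (-R₀ - R₁ + R₂)) - 54 * algebraMap K _ W.c₆))
    (hY₀ : ((Y₀ : W.xDivisionField 3) : AlgebraicClosure K) =
      (3 * (R₀ + R₁ + R₂)) ^ 3 - 27 * algebraMap K _ W.c₄ * (3 * (R₀ + R₁ + R₂)) - 54 * algebraMap K _ W.c₆)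
    (hY₂ : ((Y₂ : W.xDivisionField 3) : AlgebraicClosure K) =
      (3 * (R₀ - R₁ - R₂)) ^ 3 - 27 * algebraMap K _ W.c₄ * (3 * (R₀ - R₁ - R₂)) - 54 * algebraMap K _ W.c₆)
    (hY₃ : ((Y₃ : W.xDivisionField 3) : AlgebraicClosure K) =
      (3 * (-R₀ + R₁ - R₂)) ^ 3 - 27 * algebraMap K _ W.c₄ * (3 * (-R₀ + R₁ - R₂)) - 54 * algebraMap K _ W.c₆)
    (hY₄ : ((Y₄ : W.xDivisionField 3) : AlgebraicClosure K) =
      (3 * (-R₀ - R₁ + R₂)) ^ 3 - 27 * algebraMap K _ W.c₄ * (3 * (-R₀ - R₁ + R₂)) - 54 * algebraMap K _ W.c₆)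
    (hsP : ((sP : W.xDivisionField 3) : AlgebraicClosure K) =
      (P.map (algebraMap (𝓞 K) (AlgebraicClosure K))).eval (3 * (R₀ + R₁ + R₂)))
    {TZ TE₀ TE₁ TE₂ : ℕ} (hTZ : Odd TZ)
    (hZprod : (e₀ : ℕ∞) * ord (𝔓.comap ((W.xDivisionField 3).integralClosureToAbsIntegers (𝓞 K))) (Z * Z₂ * Z₃ * Z₄) =
      TZ * ord (𝔓.comap ((W.xDivisionField 3).integralClosureToAbsIntegers (𝓞 K)))
        (2 : integralClosure (𝓞 K) (W.xDivisionField 3)))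
    (hE₀ : (e₀ : ℕ∞) * ord (𝔓.comap ((W.xDivisionField 3).integralClosureToAbsIntegers (𝓞 K))) ((Z - Z₂) * (Z₃ - Z₄)) =
      TE₀ * ord (𝔓.comap ((W.xDivisionField 3).integralClosureToAbsIntegers (𝓞 K)))
        (2 : integralClosure (𝓞 K) (W.xDivisionField 3)))
    (hE₁ : (e₀ : ℕ∞) * ord (𝔓.comap ((W.xDivisionField 3).integralClosureToAbsIntegers (𝓞 K))) ((Z - Z₃) * (Z₂ - Z₄)) =
      TE₁ * ord (𝔓.comap ((W.xDivisionField 3).integralClosureToAbsIntegers (𝓞 K)))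
        (2 : integralClosure (𝓞 K) (W.xDivisionField 3)))
    (hE₂ : (e₀ : ℕ∞) * ord (𝔓.comap ((W.xDivisionField 3).integralClosureToAbsIntegers (𝓞 K))) ((Z - Z₄) * (Z₂ - Z₃)) =
      TE₂ * ord (𝔓.comap ((W.xDivisionField 3).integralClosureToAbsIntegers (𝓞 K)))
        (2 : integralClosure (𝓞 K) (W.xDivisionField 3)))
    (hb₀ : 2 * TE₀ - TZ ≤ 2 * ((γ + 1) * (4 * e₀)) + (16 * e₀ + 2 * e₀ * vD) - TZ)
    (hb₁ : 2 * TE₁ - TZ ≤ 2 * ((γ + 1) * (4 * e₀)) + (16 * e₀ + 2 * e₀ * vD) - TZ)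
    (hb₂ : 2 * TE₂ - TZ ≤ 2 * ((γ + 1) * (4 * e₀)) + (16 * e₀ + 2 * e₀ * vD) - TZ) :
    ((4 * e₀ : ℕ) : ℝ) * (W.torsionGaloisRep 3).swanConductorAt (𝓞 K) 𝔓 =
      2 * ((2 * ((γ + 1) * (4 * e₀)) + (16 * e₀ + 2 * e₀ * vD) - TZ : ℕ) +
        (((2 * TE₀ - TZ) + (2 * TE₁ - TZ) + (2 * TE₂ - TZ) : ℕ) : ℝ)) := by
  classical
  haveI : Fact (Nat.Prime 3) := ⟨Nat.prime_three⟩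
  have h3 : ((3 : ℕ) : 𝓞 K) ∉ v.asIdeal := by
    intro h3v
    have e : (1 : 𝓞 K) = ((3 : ℕ) : 𝓞 K) - 2 := by norm_num
    have h1 : (1 : 𝓞 K) ∈ v.asIdeal := by rw [e]; exact Ideal.sub_mem _ h3v hv2
    exact v.isPrime.ne_top ((Ideal.eq_top_iff_one _).mpr h1)
  haveI hDDE : IsDedekindDomain (integralClosure (𝓞 K) (W.xDivisionField 3)) :=
    integralClosure.isDedekindDomain (𝓞 K) K (W.xDivisionField 3)
  haveI : 𝔓.IsPrime := h𝔓.1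
  haveI h𝔓max : 𝔓.IsMaximal := HeightOneSpectrum.isMaximal_of_mem_primesAbove h𝔓
  haveI : IsGalois K (W.xDivisionField 3) := {}
  haveI hPEmax : (𝔓.comap ((W.xDivisionField 3).integralClosureToAbsIntegers (𝓞 K))).IsMaximal :=
    isMaximal_comap_integralClosureToAbsIntegers (𝓞 K) 𝔓 (W.xDivisionField 3)
  have hunderE : (𝔓.comap ((W.xDivisionField 3).integralClosureToAbsIntegers (𝓞 K))).under (𝓞 K) = v.asIdeal := by
    rw [under_comap_integralClosureToAbsIntegers, ← h𝔓.2.over]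
  have h2E : (2 : integralClosure (𝓞 K) (W.xDivisionField 3)) ∈
      𝔓.comap ((W.xDivisionField 3).integralClosureToAbsIntegers (𝓞 K)) := by
    have : (2 : 𝓞 K) ∈ (𝔓.comap ((W.xDivisionField 3).integralClosureToAbsIntegers (𝓞 K))).under (𝓞 K) := by
      rw [hunderE]; exact hv2
    rw [Ideal.under_def, Ideal.mem_comap, map_ofNat] at this
    exact this
  have hPE0 : (𝔓.comap ((W.xDivisionField 3).integralClosureToAbsIntegers (𝓞 K))) ≠ ⊥ := by
    intro h0; rw [h0] at h2E
    exact two_ne_zero ((Ideal.mem_bot).mp h2E)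
  -- (L8) `v_E(2) = #Q₀ = 4 e₀`
  have hL8 : ord (𝔓.comap ((W.xDivisionField 3).integralClosureToAbsIntegers (𝓞 K)))
      (2 : integralClosure (𝓞 K) (W.xDivisionField 3)) = ((4 * e₀ : ℕ) : ℕ∞) := by
    have h := ord_algebraMap_eq_card_inertia_of_mem_primesAbove h𝔓 (W.xDivisionField 3) hv2 hπ2
    rw [map_ofNat, hG₀] at h
    exact h
  have he₀ : 0 < e₀ := by
    by_contra h0
    have h00 : e₀ = 0 := by omega
    rw [h00, mul_zero, Nat.cast_zero, ord_eq_zero_iff] at hL8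
    exact hL8 h2E
  -- conversion of the certificates: `e₀ v(X) = T v(2)` gives `v(X) = 4T`
  have hconv : ∀ (X : integralClosure (𝓞 K) (W.xDivisionField 3)) (T : ℕ),
      (e₀ : ℕ∞) * ord (𝔓.comap ((W.xDivisionField 3).integralClosureToAbsIntegers (𝓞 K))) X =
        T * ord (𝔓.comap ((W.xDivisionField 3).integralClosureToAbsIntegers (𝓞 K)))
          (2 : integralClosure (𝓞 K) (W.xDivisionField 3)) →
      ord (𝔓.comap ((W.xDivisionField 3).integralClosureToAbsIntegers (𝓞 K))) X = ((4 * T : ℕ) : ℕ∞) := by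
    intro X T h
    rw [hL8] at h
    rcases eq_or_ne (ord (𝔓.comap ((W.xDivisionField 3).integralClosureToAbsIntegers (𝓞 K))) X) ⊤ with htop | hne
    · exfalso
      rw [htop, ENat.mul_top (by exact_mod_cast he₀.ne'), ← Nat.cast_mul] at h
      exact ENat.top_ne_coe _ h
    · obtain ⟨m, hm⟩ := ENat.ne_top_iff_exists.mp hne
      rw [← hm] at h ⊢
      have h' : e₀ * m = T * (4 * e₀) := by exact_mod_cast h
      have hm' : m = 4 * T := Nat.eq_of_mul_eq_mul_left he₀ (by rw [h']; ring)
      rw [hm']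
  have hZprod' := hconv _ _ hZprod
  have hE₀' : ord (𝔓.comap ((W.xDivisionField 3).integralClosureToAbsIntegers (𝓞 K))) ((Z - Z₂) * (Z₃ - Z₄)) =
      ((2 * (2 * TE₀) : ℕ) : ℕ∞) := by rw [hconv _ _ hE₀, show 4 * TE₀ = 2 * (2 * TE₀) by ring]
  have hE₁' : ord (𝔓.comap ((W.xDivisionField 3).integralClosureToAbsIntegers (𝓞 K))) ((Z - Z₃) * (Z₂ - Z₄)) =
      ((2 * (2 * TE₁) : ℕ) : ℕ∞) := by rw [hconv _ _ hE₁, show 4 * TE₁ = 2 * (2 * TE₁) by ring]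
  have hE₂' : ord (𝔓.comap ((W.xDivisionField 3).integralClosureToAbsIntegers (𝓞 K))) ((Z - Z₄) * (Z₂ - Z₃)) =
      ((2 * (2 * TE₂) : ℕ) : ℕ∞) := by rw [hconv _ _ hE₂, show 4 * TE₂ = 2 * (2 * TE₂) by ring]
  have hnu : ((TZ : integralClosure (𝓞 K) (W.xDivisionField 3))) ∉
      𝔓.comap ((W.xDivisionField 3).integralClosureToAbsIntegers (𝓞 K)) := by
    have hodd : Odd (TZ : ℤ) := by obtain ⟨k, hk⟩ := hTZ; exact ⟨k, by omega⟩
    have := W.intCast_notMem_of_odd hv2 h𝔓 hodd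
    rwa [Int.cast_natCast] at this
  have hoD : ord (𝔓.comap ((W.xDivisionField 3).integralClosureToAbsIntegers (𝓞 K)))
      (algebraMap (𝓞 K) (integralClosure (𝓞 K) (W.xDivisionField 3)) D) = ((vD * (4 * e₀) : ℕ) : ℕ∞) := by
    rw [hDfac, ord_mul _ hPE0, ord_pow _ hPE0, hL8, (ord_eq_zero_iff _).mpr hDu, add_zero]; push_cast; ring
  have hκ : ord (𝔓.comap ((W.xDivisionField 3).integralClosureToAbsIntegers (𝓞 K)))
      (algebraMap (𝓞 K) (integralClosure (𝓞 K) (W.xDivisionField 3)) (2 * 2 ^ γ)) =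
        (((γ + 1) * (4 * e₀) : ℕ) : ℕ∞) := by
    rw [map_mul, map_pow, map_ofNat, ← pow_succ', ord_pow _ hPE0, hL8]; push_cast; ring
  have hB := W.card_mul_swanConductorAt_torsion_three_eq_of_fakePoint_prod hv2 h3 h𝔓 hζ hδ h₀ h₁ h₂ hρ hc₆ hD hcard
    hZ hZ₂ hZ₃ hZ₄ hY₀ hY₂ hY₃ hY₄ hsP (n₀ := 16 * e₀ + 2 * e₀ * vD) hZprod' hnu hL8 hoD (by ring) hκ
    hE₀' hE₁' hE₂' hb₀ hb₁ hb₂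
  rw [hG₀] at hB
  exact hB

set_option maxHeartbeats 1600000 in
set_option synthInstance.maxHeartbeats 400000 in
/-- **The case `e₀ = 3` (`3 ∤ v(Δ)`): `12 · Sw_𝔓(E[3])` from the certificates.**  Setting of
`card_mul_swanConductorAt_torsion_three_eq_of_fakePoint_cert`; in addition the three quadratic
defects `A_k - s_k²` (`A_k = (q_k R_k)²`, `s_k` fixed by every `σ` fixing `ζ, δ`) with certificates
`3 v(A_k - s_k²) = t_k v(2)` (`t_k` odd), `3 v(2 s_k) = σ_k v(2)`, `t_k ≤ 2σ_k`, and `3 ∤ v_Δ`.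
Then `#Q₁ = 4` (`card_ramificationSubgroup_one_xDivisionField_three_eq_four_of_sq`), `#Q₀ = 12`
(`card_inertia_xDivisionField_three_eq_twelve`), and
`12 · Sw_𝔓(E[3]) = 2 ((2 · 12(γ+1) + (48 + 6v_Δ) - T_Z) + Σ_k (2T_k - T_Z))`.
[cite: SilvermanATAEC1994, Thm. IV.11.1] [cite: SerreLocalFields1979, Ch. IV §1–§2] -/
theorem swanConductorAt_torsion_three_of_fakePoint_cert_three [W.IsElliptic]
    {v : HeightOneSpectrum (𝓞 K)} (hv2 : (2 : 𝓞 K) ∈ v.asIdeal) (hπ2 : (2 : 𝓞 K) ∉ v.asIdeal ^ 2)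
    {𝔓 : Ideal (absIntegers (𝓞 K) K)} (h𝔓 : 𝔓 ∈ v.primesAbove)
    {ζ δ R₀ R₁ R₂ : AlgebraicClosure K} (hζ : ζ ^ 2 + ζ + 1 = 0)
    (hδ : δ ^ 3 = algebraMap K (AlgebraicClosure K) W.Δ)
    (h₀ : R₀ ^ 2 = algebraMap K (AlgebraicClosure K) W.c₄ - 12 * δ)
    (h₁ : R₁ ^ 2 = algebraMap K (AlgebraicClosure K) W.c₄ - 12 * ζ * δ)
    (h₂ : R₂ ^ 2 = algebraMap K (AlgebraicClosure K) W.c₄ - 12 * ζ ^ 2 * δ)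
    (hρ : R₀ * R₁ * R₂ = algebraMap K (AlgebraicClosure K) W.c₆) (hc₆ : W.c₆ ≠ 0)
    {D : 𝓞 K} (hD : algebraMap (𝓞 K) K D = W.Δ)
    {Du : integralClosure (𝓞 K) (W.xDivisionField 3)} {vD : ℕ}
    (hDfac : algebraMap (𝓞 K) (integralClosure (𝓞 K) (W.xDivisionField 3)) D = 2 ^ vD * Du)
    (hDu : Du ∉ 𝔓.comap ((W.xDivisionField 3).integralClosureToAbsIntegers (𝓞 K))) (h3vD : ¬ 3 ∣ vD)
    -- defects
    {q₀ q₁ q₂ : AlgebraicClosure K} (mq₀ : q₀ ∈ W.xDivisionField 3) (mq₁ : q₁ ∈ W.xDivisionField 3)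
    (mq₂ : q₂ ∈ W.xDivisionField 3)
    (hq₀ : ∀ σ : absoluteGaloisGroup K, σ • ζ = ζ → σ • δ = δ → σ • q₀ = q₀)
    (hq₁ : ∀ σ : absoluteGaloisGroup K, σ • ζ = ζ → σ • δ = δ → σ • q₁ = q₁)
    (hq₂ : ∀ σ : absoluteGaloisGroup K, σ • ζ = ζ → σ • δ = δ → σ • q₂ = q₂)
    {A₀ A₁ A₂ s₀ s₁ s₂ : integralClosure (𝓞 K) (W.xDivisionField 3)}
    (hA₀ : ((A₀ : W.xDivisionField 3) : AlgebraicClosure K) = (q₀ * R₀) ^ 2)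
    (hA₁ : ((A₁ : W.xDivisionField 3) : AlgebraicClosure K) = (q₁ * R₁) ^ 2)
    (hA₂ : ((A₂ : W.xDivisionField 3) : AlgebraicClosure K) = (q₂ * R₂) ^ 2)
    (hs₀ : ∀ σ : absoluteGaloisGroup K, σ • ζ = ζ → σ • δ = δ →
      σ • ((s₀ : W.xDivisionField 3) : AlgebraicClosure K) = ((s₀ : W.xDivisionField 3) : AlgebraicClosure K))
    (hs₁ : ∀ σ : absoluteGaloisGroup K, σ • ζ = ζ → σ • δ = δ →
      σ • ((s₁ : W.xDivisionField 3) : AlgebraicClosure K) = ((s₁ : W.xDivisionField 3) : AlgebraicClosure K))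
    (hs₂ : ∀ σ : absoluteGaloisGroup K, σ • ζ = ζ → σ • δ = δ →
      σ • ((s₂ : W.xDivisionField 3) : AlgebraicClosure K) = ((s₂ : W.xDivisionField 3) : AlgebraicClosure K))
    {t₀ t₁ t₂ σ₀ σ₁ σ₂ : ℕ} (hto₀ : Odd t₀) (hto₁ : Odd t₁) (hto₂ : Odd t₂)
    (ht₀ : 3 * ord (𝔓.comap ((W.xDivisionField 3).integralClosureToAbsIntegers (𝓞 K))) (A₀ - s₀ ^ 2) =
      t₀ * ord (𝔓.comap ((W.xDivisionField 3).integralClosureToAbsIntegers (𝓞 K)))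
        (2 : integralClosure (𝓞 K) (W.xDivisionField 3)))
    (ht₁ : 3 * ord (𝔓.comap ((W.xDivisionField 3).integralClosureToAbsIntegers (𝓞 K))) (A₁ - s₁ ^ 2) =
      t₁ * ord (𝔓.comap ((W.xDivisionField 3).integralClosureToAbsIntegers (𝓞 K)))
        (2 : integralClosure (𝓞 K) (W.xDivisionField 3)))
    (ht₂ : 3 * ord (𝔓.comap ((W.xDivisionField 3).integralClosureToAbsIntegers (𝓞 K))) (A₂ - s₂ ^ 2) =
      t₂ * ord (𝔓.comap ((W.xDivisionField 3).integralClosureToAbsIntegers (𝓞 K)))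
        (2 : integralClosure (𝓞 K) (W.xDivisionField 3)))
    (hσ₀ : 3 * ord (𝔓.comap ((W.xDivisionField 3).integralClosureToAbsIntegers (𝓞 K))) (2 * s₀) =
      σ₀ * ord (𝔓.comap ((W.xDivisionField 3).integralClosureToAbsIntegers (𝓞 K)))
        (2 : integralClosure (𝓞 K) (W.xDivisionField 3)))
    (hσ₁ : 3 * ord (𝔓.comap ((W.xDivisionField 3).integralClosureToAbsIntegers (𝓞 K))) (2 * s₁) =
      σ₁ * ord (𝔓.comap ((W.xDivisionField 3).integralClosureToAbsIntegers (𝓞 K)))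
        (2 : integralClosure (𝓞 K) (W.xDivisionField 3)))
    (hσ₂ : 3 * ord (𝔓.comap ((W.xDivisionField 3).integralClosureToAbsIntegers (𝓞 K))) (2 * s₂) =
      σ₂ * ord (𝔓.comap ((W.xDivisionField 3).integralClosureToAbsIntegers (𝓞 K)))
        (2 : integralClosure (𝓞 K) (W.xDivisionField 3)))
    (htσ₀ : t₀ ≤ 2 * σ₀) (htσ₁ : t₁ ≤ 2 * σ₁) (htσ₂ : t₂ ≤ 2 * σ₂)
    -- fake point
    {Z Z₂ Z₃ Z₄ Y₀ Y₂ Y₃ Y₄ sP : integralClosure (𝓞 K) (W.xDivisionField 3)} {P : Polynomial (𝓞 K)} {γ : ℕ}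
    (hZ : ((Z : W.xDivisionField 3) : AlgebraicClosure K) =
      (P.map (algebraMap (𝓞 K) (AlgebraicClosure K))).eval (3 * (R₀ + R₁ + R₂)) ^ 2 -
        algebraMap (𝓞 K) (AlgebraicClosure K) (2 ^ γ) ^ 2 * ((3 * (R₀ + R₁ + R₂)) ^ 3
          - 27 * algebraMap K _ W.c₄ * (3 * (R₀ + R₁ + R₂)) - 54 * algebraMap K _ W.c₆))
    (hZ₂ : ((Z₂ : W.xDivisionField 3) : AlgebraicClosure K) =
      (P.map (algebraMap (𝓞 K) (AlgebraicClosure K))).eval (3 * (R₀ - R₁ - R₂)) ^ 2 -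
        algebraMap (𝓞 K) (AlgebraicClosure K) (2 ^ γ) ^ 2 * ((3 * (R₀ - R₁ - R₂)) ^ 3
          - 27 * algebraMap K _ W.c₄ * (3 * (R₀ - R₁ - R₂)) - 54 * algebraMap K _ W.c₆))
    (hZ₃ : ((Z₃ : W.xDivisionField 3) : AlgebraicClosure K) =
      (P.map (algebraMap (𝓞 K) (AlgebraicClosure K))).eval (3 * (-R₀ + R₁ - R₂)) ^ 2 -
        algebraMap (𝓞 K) (AlgebraicClosure K) (2 ^ γ) ^ 2 * ((3 * (-R₀ + R₁ - R₂)) ^ 3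
          - 27 * algebraMap K _ W.c₄ * (3 * (-R₀ + R₁ - R₂)) - 54 * algebraMap K _ W.c₆))
    (hZ₄ : ((Z₄ : W.xDivisionField 3) : AlgebraicClosure K) =
      (P.map (algebraMap (𝓞 K) (AlgebraicClosure K))).eval (3 * (-R₀ - R₁ + R₂)) ^ 2 -
        algebraMap (𝓞 K) (AlgebraicClosure K) (2 ^ γ) ^ 2 * ((3 * (-R₀ - R₁ + R₂)) ^ 3
          - 27 * algebraMap K _ W.c₄ * (3 * (-R₀ - R₁ + R₂)) - 54 * algebraMap K _ W.c₆))
    (hY₀ : ((Y₀ : W.xDivisionField 3) : AlgebraicClosure K) =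
      (3 * (R₀ + R₁ + R₂)) ^ 3 - 27 * algebraMap K _ W.c₄ * (3 * (R₀ + R₁ + R₂)) - 54 * algebraMap K _ W.c₆)
    (hY₂ : ((Y₂ : W.xDivisionField 3) : AlgebraicClosure K) =
      (3 * (R₀ - R₁ - R₂)) ^ 3 - 27 * algebraMap K _ W.c₄ * (3 * (R₀ - R₁ - R₂)) - 54 * algebraMap K _ W.c₆)
    (hY₃ : ((Y₃ : W.xDivisionField 3) : AlgebraicClosure K) =
      (3 * (-R₀ + R₁ - R₂)) ^ 3 - 27 * algebraMap K _ W.c₄ * (3 * (-R₀ + R₁ - R₂)) - 54 * algebraMap K _ W.c₆)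
    (hY₄ : ((Y₄ : W.xDivisionField 3) : AlgebraicClosure K) =
      (3 * (-R₀ - R₁ + R₂)) ^ 3 - 27 * algebraMap K _ W.c₄ * (3 * (-R₀ - R₁ + R₂)) - 54 * algebraMap K _ W.c₆)
    (hsP : ((sP : W.xDivisionField 3) : AlgebraicClosure K) =
      (P.map (algebraMap (𝓞 K) (AlgebraicClosure K))).eval (3 * (R₀ + R₁ + R₂)))
    {TZ TE₀ TE₁ TE₂ : ℕ} (hTZ : Odd TZ)
    (hZprod : 3 * ord (𝔓.comap ((W.xDivisionField 3).integralClosureToAbsIntegers (𝓞 K))) (Z * Z₂ * Z₃ * Z₄) =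
      TZ * ord (𝔓.comap ((W.xDivisionField 3).integralClosureToAbsIntegers (𝓞 K)))
        (2 : integralClosure (𝓞 K) (W.xDivisionField 3)))
    (hE₀ : 3 * ord (𝔓.comap ((W.xDivisionField 3).integralClosureToAbsIntegers (𝓞 K))) ((Z - Z₂) * (Z₃ - Z₄)) =
      TE₀ * ord (𝔓.comap ((W.xDivisionField 3).integralClosureToAbsIntegers (𝓞 K)))
        (2 : integralClosure (𝓞 K) (W.xDivisionField 3)))
    (hE₁ : 3 * ord (𝔓.comap ((W.xDivisionField 3).integralClosureToAbsIntegers (𝓞 K))) ((Z - Z₃) * (Z₂ - Z₄)) =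
      TE₁ * ord (𝔓.comap ((W.xDivisionField 3).integralClosureToAbsIntegers (𝓞 K)))
        (2 : integralClosure (𝓞 K) (W.xDivisionField 3)))
    (hE₂ : 3 * ord (𝔓.comap ((W.xDivisionField 3).integralClosureToAbsIntegers (𝓞 K))) ((Z - Z₄) * (Z₂ - Z₃)) =
      TE₂ * ord (𝔓.comap ((W.xDivisionField 3).integralClosureToAbsIntegers (𝓞 K)))
        (2 : integralClosure (𝓞 K) (W.xDivisionField 3)))
    (hb₀ : 2 * TE₀ - TZ ≤ 2 * ((γ + 1) * (4 * 3)) + (16 * 3 + 2 * 3 * vD) - TZ)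
    (hb₁ : 2 * TE₁ - TZ ≤ 2 * ((γ + 1) * (4 * 3)) + (16 * 3 + 2 * 3 * vD) - TZ)
    (hb₂ : 2 * TE₂ - TZ ≤ 2 * ((γ + 1) * (4 * 3)) + (16 * 3 + 2 * 3 * vD) - TZ) :
    ((4 * 3 : ℕ) : ℝ) * (W.torsionGaloisRep 3).swanConductorAt (𝓞 K) 𝔓 =
      2 * ((2 * ((γ + 1) * (4 * 3)) + (16 * 3 + 2 * 3 * vD) - TZ : ℕ) +
        (((2 * TE₀ - TZ) + (2 * TE₁ - TZ) + (2 * TE₂ - TZ) : ℕ) : ℝ)) := by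
  classical
  haveI : Fact (Nat.Prime 3) := ⟨Nat.prime_three⟩
  have h3 : ((3 : ℕ) : 𝓞 K) ∉ v.asIdeal := by
    intro h3v
    have e : (1 : 𝓞 K) = ((3 : ℕ) : 𝓞 K) - 2 := by norm_num
    have h1 : (1 : 𝓞 K) ∈ v.asIdeal := by rw [e]; exact Ideal.sub_mem _ h3v hv2
    exact v.isPrime.ne_top ((Ideal.eq_top_iff_one _).mpr h1)
  haveI hDDE : IsDedekindDomain (integralClosure (𝓞 K) (W.xDivisionField 3)) :=
    integralClosure.isDedekindDomain (𝓞 K) K (W.xDivisionField 3)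
  haveI : 𝔓.IsPrime := h𝔓.1
  haveI h𝔓max : 𝔓.IsMaximal := HeightOneSpectrum.isMaximal_of_mem_primesAbove h𝔓
  haveI : IsGalois K (W.xDivisionField 3) := {}
  haveI hPEmax : (𝔓.comap ((W.xDivisionField 3).integralClosureToAbsIntegers (𝓞 K))).IsMaximal :=
    isMaximal_comap_integralClosureToAbsIntegers (𝓞 K) 𝔓 (W.xDivisionField 3)
  have hunderE : (𝔓.comap ((W.xDivisionField 3).integralClosureToAbsIntegers (𝓞 K))).under (𝓞 K) = v.asIdeal := by
    rw [under_comap_integralClosureToAbsIntegers, ← h𝔓.2.over]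
  have h2E : (2 : integralClosure (𝓞 K) (W.xDivisionField 3)) ∈
      𝔓.comap ((W.xDivisionField 3).integralClosureToAbsIntegers (𝓞 K)) := by
    have : (2 : 𝓞 K) ∈ (𝔓.comap ((W.xDivisionField 3).integralClosureToAbsIntegers (𝓞 K))).under (𝓞 K) := by
      rw [hunderE]; exact hv2
    rw [Ideal.under_def, Ideal.mem_comap, map_ofNat] at this
    exact this
  have hPE0 : (𝔓.comap ((W.xDivisionField 3).integralClosureToAbsIntegers (𝓞 K))) ≠ ⊥ := by
    intro h0; rw [h0] at h2E
    exact two_ne_zero ((Ideal.mem_bot).mp h2E)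
  -- `v_E(2) = o'` is finite and positive
  obtain ⟨o', ho'⟩ := exists_ord_eq_natCast _ hPE0
    (two_ne_zero : (2 : integralClosure (𝓞 K) (W.xDivisionField 3)) ≠ 0)
  have h2S : algebraMap (𝓞 K) (integralClosure (𝓞 K) (W.xDivisionField 3)) 2 = 2 := map_ofNat _ 2
  -- the slope bounds `v(A_k - s_k²) ≤ 2 v(2 s_k)`
  have hle : ∀ (X Y : integralClosure (𝓞 K) (W.xDivisionField 3)) (t σ : ℕ),
      3 * ord (𝔓.comap ((W.xDivisionField 3).integralClosureToAbsIntegers (𝓞 K))) X =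
        t * ord (𝔓.comap ((W.xDivisionField 3).integralClosureToAbsIntegers (𝓞 K)))
          (2 : integralClosure (𝓞 K) (W.xDivisionField 3)) →
      3 * ord (𝔓.comap ((W.xDivisionField 3).integralClosureToAbsIntegers (𝓞 K))) Y =
        σ * ord (𝔓.comap ((W.xDivisionField 3).integralClosureToAbsIntegers (𝓞 K)))
          (2 : integralClosure (𝓞 K) (W.xDivisionField 3)) →
      t ≤ 2 * σ →
      ord (𝔓.comap ((W.xDivisionField 3).integralClosureToAbsIntegers (𝓞 K))) X ≤
        2 * ord (𝔓.comap ((W.xDivisionField 3).integralClosureToAbsIntegers (𝓞 K))) Y := by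
    intro X Y t σ hX hY htσ
    rw [ho'] at hX hY
    rcases eq_or_ne (ord (𝔓.comap ((W.xDivisionField 3).integralClosureToAbsIntegers (𝓞 K))) Y) ⊤ with hYt | hYne
    · rw [hYt]; simp
    obtain ⟨mY, hmY⟩ := ENat.ne_top_iff_exists.mp hYne
    rcases eq_or_ne (ord (𝔓.comap ((W.xDivisionField 3).integralClosureToAbsIntegers (𝓞 K))) X) ⊤ with hXt | hXne
    · exfalso
      rw [hXt, ENat.mul_top (by norm_num), ← Nat.cast_mul] at hX
      exact ENat.top_ne_coe _ hX
    obtain ⟨mX, hmX⟩ := ENat.ne_top_iff_exists.mp hXne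
    rw [← hmX] at hX ⊢
    rw [← hmY] at hY ⊢
    have hX' : 3 * mX = t * o' := by exact_mod_cast hX
    have hY' : 3 * mY = σ * o' := by exact_mod_cast hY
    have : mX ≤ 2 * mY := by nlinarith
    exact_mod_cast this
  -- `#Q₁ = 4`
  have hcard := W.card_ramificationSubgroup_one_xDivisionField_three_eq_four_of_sq hv2 h3 h𝔓 hζ hδ h₀ h₁ h₂ hρ hc₆
    hv2 hπ2 mq₀ mq₁ mq₂ hq₀ hq₁ hq₂ hA₀ hA₁ hA₂ hs₀ hs₁ hs₂ (e₀ := 3) (by decide) hto₀ hto₁ hto₂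
    (by rw [h2S]; exact_mod_cast ht₀) (by rw [h2S]; exact_mod_cast ht₁) (by rw [h2S]; exact_mod_cast ht₂)
    (hle _ _ _ _ ht₀ hσ₀ htσ₀) (hle _ _ _ _ ht₁ hσ₁ htσ₁) (hle _ _ _ _ ht₂ hσ₂ htσ₂)
  -- `#Q₀ = 12`
  have hvD : ord (𝔓.comap ((W.xDivisionField 3).integralClosureToAbsIntegers (𝓞 K)))
        (algebraMap (𝓞 K) (integralClosure (𝓞 K) (W.xDivisionField 3)) D) =
      vD * ord (𝔓.comap ((W.xDivisionField 3).integralClosureToAbsIntegers (𝓞 K)))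
        (algebraMap (𝓞 K) (integralClosure (𝓞 K) (W.xDivisionField 3)) 2) := by
    rw [h2S, hDfac, ord_mul _ hPE0, ord_pow _ hPE0, (ord_eq_zero_iff _).mpr hDu, add_zero]
  have hG₀ := W.card_inertia_xDivisionField_three_eq_twelve hv2 h3 h𝔓 hζ hδ h₀ h₁ h₂ hρ hc₆ hcard hv2 hπ2 hD h3vD hvD
  exact W.card_mul_swanConductorAt_torsion_three_eq_of_fakePoint_cert hv2 hπ2 h𝔓 hζ hδ h₀ h₁ h₂ hρ hc₆ hD hcard
    (e₀ := 3) hG₀ hDfac hDu hZ hZ₂ hZ₃ hZ₄ hY₀ hY₂ hY₃ hY₄ hsP hTZ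
    (by exact_mod_cast hZprod) (by exact_mod_cast hE₀) (by exact_mod_cast hE₁) (by exact_mod_cast hE₂) hb₀ hb₁ hb₂

end WeierstrassCurve

end
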